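import Literature.RepresentationTheory.MoeglinVignerasWaldspurger1987.RankOneThetaLiftTwistRigiditySplit
import Literature.RepresentationTheory.MoeglinVignerasWaldspurger1987.RankOneThetaLiftTwistReduction
import Literature.NumberTheory.Automorphic.AdelicSecondCountable
import HarnessLib

/-!
# Twist rigidity of the rank-one theta lift at a SPLIT place: reduction of the `μ`-clause (row IV-4c4) to ONE splitting and a UNITARY twist

Topic `RepresentationTheory/MoeglinVignerasWaldspurger1987`; THEOREMS ONLY (no definition, no named fact, no `sorry`).
Split-place companion of `RankOneThetaLiftTwistReduction.lean` (B-p05, row IV-4c3, non-split places): the named fact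
`rankOne_theta_twist_rigidity_split` (`RankOneThetaLiftTwistRigiditySplit.lean`: at a split `v`, two splittings `s₁, s₂`
of `U(J)(F_v)` over `ι` with SMOOTH and `L²`-ISOMETRIC Weil representations and `Θ_{s₁}(χ₁) ≅ Θ_{s₂}(χ₂) ≠ 0` are EQUAL)
FOLLOWS from TWIST RIGIDITY FOR ONE SPLITTING AND A UNITARY TWIST:
«for every splitting `s` over `ι` with `ω_s` smooth and `L²(μ'³)`-isometric, every character `η` of `U(J)(F_v)` with open
kernel and `|η| = 1`, and all unitary continuous `χ, χ′`: `Θ_s(χ) ≠ 0` and `Θ_s(χ) ≅ η ⊗ Θ_s(χ′)` imply `η = 1`»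
(`rankOne_theta_twist_rigidity_split_of_twistRigid`).  The proof is B-p05's (`rankOne_theta_twist_rigidity_of_twistRigid`)
with ONE change: at a split place the centre `U(J₁)(F_v) ≅ F_vˣ` is NOT compact, and the unitarity of `η` (hence of
`η_Z = η ∘ centre` and of `χ′ = χ₂ η_Z⁻¹`) comes instead from the `L²`-isometry of BOTH Weil representations
(`Representation.IsL2Isometric.norm_eq_one_of_twist`, `SchwartzBruhatL2Norm`): `ω_{s₂} = η • ω_{s₁}` with both sides
isometric forces `|η| = 1` — exactly the load-bearing use of unitarity announced in the fact's docstring (on `GL₃(F_v)` the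
characters `|det|^t` are not unitary).  The net content of IV-4c4 is thereby isolated as: «`Θ_s(χ) ⊗ (η∘det)`, `η` unitary,
`≅ Θ_s(χ′)` forces `η = 1`», which by the split-place model (row IV-3(a)) and the irreducibility / rigidity of
`(ν ∘ det) × χ′` (`Zelevinsky1980/UnitaryCharacterInductionRegular`, `Zelevinsky1980/InducedCharacterRigidity`) is the
statement that the unitary inducing datum is determined by the representation ([Liu2021, App. D proof of Lem. D.1, split
case]; [Minguez2008, Thm. 1]); NOT proved here.

## References
* [Liu2021] Y. Liu, Camb. J. Math. 9 (2021) = arXiv:2102.11518 — App. D Lem. D.1 (3) (l. 5233) and proof, split case (l. 5253).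
* [GelbartRogawski1991] S. Gelbart, J. Rogawski, Invent. Math. 105 (1991), §3.1 Remark p. 457 (splittings differ by characters).
* [MoeglinVignerasWaldspurger1987] MVW, LNM 1291, Chap. 2 II.1 (B); Chap. 3 §III–IV.
-/

noncomputable section

namespace Literature.RepresentationTheory.MoeglinVignerasWaldspurger1987

open NumberField IsDedekindDomain
open scoped Matrix
open _root_.MeasureTheory
open Literature.RepresentationTheory (SeesawScalar.twist SeesawScalar.twist_apply)
open Literature.RepresentationTheory.HeisenbergGroup
open Literature.NumberTheory.GelbartRogawski1991.UnitaryDualPair.LocalSplitting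
open Literature.NumberTheory.Automorphic
open Literature.NumberTheory.Automorphic.UnitaryGroup
open Literature.NumberTheory.Automorphic.Liu2021

/-- A homomorphism into `ℂˣ` with open kernel is continuous (it is constant on the cosets of its kernel). [folklore] -/
private theorem continuous_of_isOpen_ker'' {Γ : Type*} [Group Γ] [TopologicalSpace Γ] [IsTopologicalGroup Γ]
    (ψ : Γ →* ℂˣ) (hψ : IsOpen ((ψ.ker : Subgroup Γ) : Set Γ)) : Continuous ψ := by
  refine (IsLocallyConstant.iff_exists_open _).2 (fun γ => ?_) |>.continuous
  refine ⟨(fun κ => γ * κ) '' (ψ.ker : Set Γ), (isOpenMap_mul_left γ) _ hψ, ⟨1, ψ.ker.one_mem, mul_one γ⟩, ?_⟩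
  rintro _ ⟨κ, hκ, rfl⟩
  rw [map_mul, (MonoidHom.mem_ker).1 hκ, mul_one]

-- thirty-binder statement and context (the fact's `show … from` ascriptions reproduced verbatim); about 2× the default budget
set_option maxHeartbeats 400000 in
/-- **Row IV-4c4 reduces to twist rigidity for ONE splitting and a UNITARY twist.**  If for every splitting `s` of
`U(J)(F_v)` over `ι` at a SPLIT place `v` with `ω_s` smooth and `L²(μ'³)`-isometric, every character
`η : U(J)(F_v) → ℂˣ` with OPEN kernel and `|η| = 1`, and all unitary continuous characters `χ, χ′` of the centre
`U(J₁)(F_v)`, the conditions `Θ_s(χ) ≠ 0` and `Θ_s(χ) ≅ η ⊗ Θ_s(χ′)` force `η = 1`, then the named fact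
`rankOne_theta_twist_rigidity_split` (`Θ_{s₁}(χ₁) ≅ Θ_{s₂}(χ₂) ≠ 0 ⇒ s₁ = s₂`, both `ω_{sᵢ}` smooth and `L²`-isometric) holds:
`s₂ = η • s₁` for a character `η` with open kernel (`MpPsi.exists_character_of_proj_eq`, `isOpen_ker_of_twist_of_isSmoothVector`)
which is UNITARY because `ω_{s₂} = η • ω_{s₁}` with both sides `L²`-isometric (`Representation.IsL2Isometric.norm_eq_one_of_twist`);
then `Θ_{s₂}(χ₂) ≅ η ⊗ Θ_{s₁}(χ₂ · η_Z⁻¹)` (`TwistedCoinv.exists_linearEquiv_of_twist`) with `η_Z = η ∘ localCenter` unitary continuous,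
so the hypothesis applies with `χ := χ₁`, `χ′ := χ₂ · η_Z⁻¹`.
[cite: Liu2021, App. D Lemma D.1 (3) (l. 5233) and proof, split case (l. 5253)]
[cite: GelbartRogawski1991, §3.1 Remark p. 457 L4–13] -/
theorem rankOne_theta_twist_rigidity_split_of_twistRigid
    (h : ∀ (F : Type) [Field F] [NumberField F] (E : Type) [Field E] [NumberField E] [Algebra F E]
      [Algebra.IsQuadraticExtension F E] (c : E ≃ₐ[F] E) (δ : E) (hcδ : c δ = -δ) (hδ : δ ≠ 0) (d : F)
      (hd : δ * δ = algebraMap F E d) (T : Matrix (Fin 3) (Fin 3) F) (hT : T.IsSymm) (_hTd : IsUnit T.det)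
      (J : Matrix (Fin 3) (Fin 3) E) (hJ : J = T.map (algebraMap F E)) (v : HeightOneSpectrum (𝓞 F))
      (_hE : ¬ IsField (UnitaryGroup.LocalRing E v))
      [MeasurableSpace (v.adicCompletion F)] [BorelSpace (v.adicCompletion F)]
      (μ' : Measure (v.adicCompletion F)) [μ'.IsAddHaarMeasure]
      (s : localPi E c 3 J v →* LocalMp F 3 T v)
      (_hs : ∀ g, MpPsi.proj _ (s g) = iota F E c 3 hcδ hδ hd T hT hJ v g)
      (_hsm : Representation.IsSmooth ((MpPsi.toRep (localSchrodinger F 3 T v)).comp s))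
      (_hL2 : Representation.IsL2Isometric (Measure.pi fun _ : Fin 3 => μ')
        ((MpPsi.toRep (localSchrodinger F 3 T v)).comp s))
      (η : localPi E c 3 J v →* ℂˣ) (_hη : IsOpen ((η.ker : Subgroup (localPi E c 3 J v)) : Set (localPi E c 3 J v)))
      (_hηu : ∀ g, ‖((η g : ℂˣ) : ℂ)‖ = 1)
      (J₁ : Matrix (Fin 1) (Fin 1) E) (hJ₁ : J₁ 0 0 ≠ 0) (χ χ' : localPi E c 1 J₁ v →* ℂˣ)
      (_hχu : ∀ z, ‖((χ z : ℂˣ) : ℂ)‖ = 1) (_hχc : Continuous fun z => ((χ z : ℂˣ) : ℂ))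
      (_hχ'u : ∀ z, ‖((χ' z : ℂˣ) : ℂ)‖ = 1) (_hχ'c : Continuous fun z => ((χ' z : ℂˣ) : ℂ))
      (_hnt : Nontrivial (TwistedCoinv.Coinv
        ((show Representation ℂ (localPi E c 1 J₁ v) (SchwartzBruhat (Fin 3 → v.adicCompletion F)) from
          ((MpPsi.toRep (localSchrodinger F 3 T v)).comp s).comp (localCenter E c 3 J J₁ hJ₁ v))) χ))
      (_hiso : AreIsomorphicRep
        (TwistedCoinv.rep
          (ρW := show Representation ℂ (localPi E c 1 J₁ v) (SchwartzBruhat (Fin 3 → v.adicCompletion F)) from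
            ((MpPsi.toRep (localSchrodinger F 3 T v)).comp s).comp (localCenter E c 3 J J₁ hJ₁ v))
          χ ((MpPsi.toRep (localSchrodinger F 3 T v)).comp s)
          (fun g z => (show Commute g (localCenter E c 3 J J₁ hJ₁ v z) from
            localCenter_comm E c 3 J J₁ hJ₁ v z g).map ((MpPsi.toRep (localSchrodinger F 3 T v)).comp s)))
        (SeesawScalar.twist η (TwistedCoinv.rep
          (ρW := show Representation ℂ (localPi E c 1 J₁ v) (SchwartzBruhat (Fin 3 → v.adicCompletion F)) from
            ((MpPsi.toRep (localSchrodinger F 3 T v)).comp s).comp (localCenter E c 3 J J₁ hJ₁ v))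
          χ' ((MpPsi.toRep (localSchrodinger F 3 T v)).comp s)
          (fun g z => (show Commute g (localCenter E c 3 J J₁ hJ₁ v z) from
            localCenter_comm E c 3 J J₁ hJ₁ v z g).map ((MpPsi.toRep (localSchrodinger F 3 T v)).comp s))))),
      η = 1) :
    rankOne_theta_twist_rigidity_split := by
  intro F _ _ E _ _ _ _ c δ hcδ hδ d hd T hT hTd J hJ v hE _ _ μ' _ s₁ s₂ hs₁ hs₂ hsm₁ hsm₂ hL2₁ hL2₂ J₁ hJ₁ χ₁ χ₂
    hχ₁u hχ₁c hχ₂u hχ₂c hnt hiso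
  classical
  /- §0 the Schrödinger model is non-zero and its measure instances -/
  haveI := secondCountableTopology_adicCompletion F v
  haveI : Nontrivial (SchwartzBruhat (Fin 3 → v.adicCompletion F)) := nontrivial_schwartzBruhat_pi
  /- §1 the two splittings differ by a character `η` with open kernel, UNITARY by the `L²`-isometry of both sides -/
  obtain ⟨η, hη⟩ := MpPsi.exists_character_of_proj_eq (localSchrodinger F 3 T v)
    (implementerUniqueUpToScalar_localSchrodinger F 3 T hTd v) s₁ s₂ (fun g => by rw [hs₁, hs₂])
  have hωη : ∀ (g : localPi E c 3 J v) (f : SchwartzBruhat (Fin 3 → v.adicCompletion F)),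
      ((MpPsi.toRep (localSchrodinger F 3 T v)).comp s₂) g f =
        ((η g : ℂˣ) : ℂ) • ((MpPsi.toRep (localSchrodinger F 3 T v)).comp s₁) g f :=
    MpPsi.toRep_comp_apply_of_forall_eq_ofScalar_mul (localSchrodinger F 3 T v) s₁ s₂ η hη
  have hω : ((MpPsi.toRep (localSchrodinger F 3 T v)).comp s₂) = SeesawScalar.twist η ((MpPsi.toRep (localSchrodinger F 3 T v)).comp s₁) :=
    MonoidHom.ext fun g => LinearMap.ext fun f => by rw [SeesawScalar.twist_apply, hωη]
  obtain ⟨Φ₀, hΦ₀⟩ := exists_ne (0 : SchwartzBruhat (Fin 3 → v.adicCompletion F))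
  have hηo : IsOpen ((η.ker : Subgroup (localPi E c 3 J v)) : Set (localPi E c 3 J v)) :=
    isOpen_ker_of_twist_of_isSmoothVector ((MpPsi.toRep (localSchrodinger F 3 T v)).comp s₁)
        ((MpPsi.toRep (localSchrodinger F 3 T v)).comp s₂) η hωη hΦ₀ (hsm₁ Φ₀) (hsm₂ Φ₀)
  have hηu : ∀ g, ‖((η g : ℂˣ) : ℂ)‖ = 1 := fun g => hL2₁.norm_eq_one_of_twist hL2₂ η hω g
  /- §2 the central restriction `η_Z` is unitary and continuous; `χ′ := χ₂ · η_Z⁻¹` -/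
  obtain ⟨ηZ, hηZ⟩ : ∃ ηZ : localPi E c 1 J₁ v →* ℂˣ, ηZ = η.comp (localCenter E c 3 J J₁ hJ₁ v) := ⟨_, rfl⟩
  have hηZ_apply : ∀ z, ηZ z = η (localCenter E c 3 J J₁ hJ₁ v z) := fun z => by rw [hηZ, MonoidHom.comp_apply]
  have hηZo : IsOpen ((ηZ.ker : Subgroup (localPi E c 1 J₁ v)) : Set (localPi E c 1 J₁ v)) := by
    have hpre : ((ηZ.ker : Subgroup (localPi E c 1 J₁ v)) : Set (localPi E c 1 J₁ v)) =
        (localCenter E c 3 J J₁ hJ₁ v) ⁻¹' ((η.ker : Subgroup (localPi E c 3 J v)) : Set (localPi E c 3 J v)) := by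
      ext z
      rw [SetLike.mem_coe, MonoidHom.mem_ker, Set.mem_preimage, SetLike.mem_coe, MonoidHom.mem_ker, hηZ_apply]
    rw [hpre]
    exact hηo.preimage (continuous_localCenter E c 3 J J₁ hJ₁ v)
  have hηZc : Continuous ηZ := continuous_of_isOpen_ker'' ηZ hηZo
  have hηZu : ∀ z, ‖((ηZ z : ℂˣ) : ℂ)‖ = 1 := fun z => by rw [hηZ_apply]; exact hηu _
  obtain ⟨χ', hχ'⟩ : ∃ χ' : localPi E c 1 J₁ v →* ℂˣ, χ' = χ₂ * ηZ⁻¹ := ⟨_, rfl⟩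
  have hχ'_apply : ∀ z, χ' z = χ₂ z * (ηZ z)⁻¹ := fun z => by rw [hχ', MonoidHom.mul_apply, MonoidHom.inv_apply]
  have hχ'u : ∀ z, ‖((χ' z : ℂˣ) : ℂ)‖ = 1 := fun z => by
    rw [hχ'_apply, Units.val_mul, norm_mul, hχ₂u, Units.val_inv_eq_inv_val, norm_inv, hηZu, inv_one, mul_one]
  have hχ'c : Continuous fun z => ((χ' z : ℂˣ) : ℂ) := by
    have h1 : Continuous fun z => ((ηZ z : ℂˣ) : ℂ)⁻¹ :=
      (Units.continuous_val.comp hηZc).inv₀ fun z => Units.ne_zero _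
    have h2 : (fun z => ((χ' z : ℂˣ) : ℂ)) = fun z => ((χ₂ z : ℂˣ) : ℂ) * ((ηZ z : ℂˣ) : ℂ)⁻¹ := by
      funext z
      rw [hχ'_apply, Units.val_mul, Units.val_inv_eq_inv_val]
    rw [h2]
    exact hχ₂c.mul h1
  /- §3 `Θ_{s₂}(χ₂) ≅ η ⊗ Θ_{s₁}(χ′)` -/
  have hcomm₁ : ∀ (g : localPi E c 3 J v) (z : localPi E c 1 J₁ v),
      Commute (((MpPsi.toRep (localSchrodinger F 3 T v)).comp s₁) g) ((
          ((MpPsi.toRep (localSchrodinger F 3 T v)).comp s₁).comp (localCenter E c 3 J J₁ hJ₁ v)) z) :=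
    fun g z => (show Commute g (localCenter E c 3 J J₁ hJ₁ v z) from localCenter_comm E c 3 J J₁ hJ₁ v z g).map ((MpPsi.toRep (localSchrodinger F 3 T v)).comp s₁)
  have hcomm₂ : ∀ (g : localPi E c 3 J v) (z : localPi E c 1 J₁ v),
      Commute (((MpPsi.toRep (localSchrodinger F 3 T v)).comp s₂) g) ((
          ((MpPsi.toRep (localSchrodinger F 3 T v)).comp s₂).comp (localCenter E c 3 J J₁ hJ₁ v)) z) :=
    fun g z => (show Commute g (localCenter E c 3 J J₁ hJ₁ v z) from localCenter_comm E c 3 J J₁ hJ₁ v z g).map ((MpPsi.toRep (localSchrodinger F 3 T v)).comp s₂)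
  have hcommη : ∀ (g : localPi E c 3 J v) (z : localPi E c 1 J₁ v),
      Commute (SeesawScalar.twist η ((MpPsi.toRep (localSchrodinger F 3 T v)).comp s₁) g) (((SeesawScalar.twist η
          ((MpPsi.toRep (localSchrodinger F 3 T v)).comp s₁)).comp (localCenter E c 3 J J₁ hJ₁ v)) z) :=
    fun g z => (show Commute g (localCenter E c 3 J J₁ hJ₁ v z) from
      localCenter_comm E c 3 J J₁ hJ₁ v z g).map (SeesawScalar.twist η ((MpPsi.toRep (localSchrodinger F 3 T v)).comp s₁))
  -- (B) transport along `ω_{s₂} = η • ω_{s₁}`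
  have hB : AreIsomorphicRep (TwistedCoinv.rep (ρW := ((MpPsi.toRep (localSchrodinger F 3 T v)).comp s₂).comp (localCenter E c 3 J J₁ hJ₁ v)) χ₂
      ((MpPsi.toRep (localSchrodinger F 3 T v)).comp s₂) hcomm₂)
      (TwistedCoinv.rep (ρW := (SeesawScalar.twist η ((MpPsi.toRep (localSchrodinger F 3 T v)).comp s₁)).comp (localCenter E c 3 J J₁ hJ₁ v)) χ₂
        (SeesawScalar.twist η ((MpPsi.toRep (localSchrodinger F 3 T v)).comp s₁)) hcommη) :=
    areIsomorphicRep_rep_of_eq (localCenter E c 3 J J₁ hJ₁ v) ((MpPsi.toRep (localSchrodinger F 3 T v)).comp s₂) (SeesawScalar.twist η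
        ((MpPsi.toRep (localSchrodinger F 3 T v)).comp s₁)) hω χ₂ hcomm₂ hcommη
  -- (C) coinvariants of the twist: `η ⊗ Θ_{s₁}(χ′) ≅ rep χ₂ (η • ω_{s₁})`
  obtain ⟨f, -, hf⟩ := TwistedCoinv.exists_linearEquiv_of_twist
    (((MpPsi.toRep (localSchrodinger F 3 T v)).comp s₁).comp (localCenter E c 3 J J₁ hJ₁ v)) ((SeesawScalar.twist η
        ((MpPsi.toRep (localSchrodinger F 3 T v)).comp s₁)).comp (localCenter E c 3 J J₁ hJ₁ v)) χ' χ₂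
    ((MpPsi.toRep (localSchrodinger F 3 T v)).comp s₁) (SeesawScalar.twist η ((MpPsi.toRep (localSchrodinger F 3 T v)).comp s₁)) hcomm₁ hcommη ηZ η
    (fun z f => by rw [MonoidHom.comp_apply, MonoidHom.comp_apply, SeesawScalar.twist_apply, hηZ_apply])
    (fun z => by rw [hχ'_apply, mul_comm (χ₂ z), ← mul_assoc, mul_inv_cancel, one_mul])
    (fun g f => by rw [SeesawScalar.twist_apply])
  have hC : AreIsomorphicRep
      (SeesawScalar.twist η (TwistedCoinv.rep (ρW := ((MpPsi.toRep (localSchrodinger F 3 T v)).comp s₁).comp (localCenter E c 3 J J₁ hJ₁ v)) χ'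
          ((MpPsi.toRep (localSchrodinger F 3 T v)).comp s₁) hcomm₁))
      (TwistedCoinv.rep (ρW := (SeesawScalar.twist η ((MpPsi.toRep (localSchrodinger F 3 T v)).comp s₁)).comp (localCenter E c 3 J J₁ hJ₁ v)) χ₂
        (SeesawScalar.twist η ((MpPsi.toRep (localSchrodinger F 3 T v)).comp s₁)) hcommη) :=
    ⟨f, hf⟩
  have hchain : AreIsomorphicRep (TwistedCoinv.rep (ρW := ((MpPsi.toRep (localSchrodinger F 3 T v)).comp s₁).comp (localCenter E c 3 J J₁ hJ₁ v)) χ₁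
      ((MpPsi.toRep (localSchrodinger F 3 T v)).comp s₁) hcomm₁)
      (SeesawScalar.twist η (TwistedCoinv.rep (ρW := ((MpPsi.toRep (localSchrodinger F 3 T v)).comp s₁).comp (localCenter E c 3 J J₁ hJ₁ v)) χ'
          ((MpPsi.toRep (localSchrodinger F 3 T v)).comp s₁) hcomm₁)) :=
    (hiso.trans hB).trans hC.symm
  /- §4 twist rigidity for `s₁` gives `η = 1`, hence `s₂ = s₁` -/
  have hη1 : η = 1 :=
    h F E c δ hcδ hδ d hd T hT hTd J hJ v hE μ' s₁ hs₁ hsm₁ hL2₁ η hηo hηu J₁ hJ₁ χ₁ χ' hχ₁u hχ₁c hχ'u hχ'c hnt hchain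
  exact MpPsi.eq_of_forall_eq_ofScalar_mul_of_eq_one (localSchrodinger F 3 T v) s₁ s₂ η hη hη1

end Literature.RepresentationTheory.MoeglinVignerasWaldspurger1987

end
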